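import Literature.Probability.RandomPlanarGeometry.SLETransienceIffTrace
import HarnessLib

/-!
# Chordal SLE_κ random curves exist in every Dobrushin domain for every `κ ≠ 8` — unconditionally

Topic `Probability/RandomPlanarGeometry`; theorems only (no definition, no new named fact).

The named fact `Literature.Probability.RandomPlanarGeometry.exists_isSLECurve` (`SLE.lean`) asks
for a chordal SLE_κ random curve in every Dobrushin domain for EVERY `κ > 0`; by
`exists_isSLECurve_iff_hasSLETrace_eight` (`SLETransienceIffTrace.lean`) it is equivalent to the
SLE₈ trace theorem of Lawler–Schramm–Werner (2004), Thm. 4.7, whose discharge is open in the tree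
(it rests on [LSW04] Thm. 4.4 / Prop. 4.5). Every OTHER value of `κ` is already settled in the
tree: generation by a curve is Rohde–Schramm's Thm. 5.1 (`hasSLETrace_of_ne_eight_apply`, from the
proved Cor. 3.5 `RohdeSchramm2005_cor35_holds`), transience is their Thm. 7.1
(`tendsto_norm_sleTrace_atTop_of_ne_eight`), and `exists_isSLECurve_at` (`SLEExistenceAt.lean`)
assembles the curve (Riemann mapping, Carathéodory, measurability of the trace: all proved).

This file only records the resulting hypothesis-free statements, so that users interested in a
single `κ ≠ 8` — the summit `CriticalPhenomena` needs `κ = 8/3` (self-avoiding walk,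
`SAW.SAWScalingLimit`) and `κ = 6` (percolation, `SLE6LimitZ2`, Cardy via SLE₆); the Ising
programme needs `κ = 3` and `κ = 16/3` — do not have to carry `exists_isSLECurve` (i.e. the SLE₈
theorem) as a hypothesis:

* `exists_isSLECurve_of_ne_eight` — for `0 < κ ≠ 8` and every Dobrushin domain `D` there is a
  chordal SLE_κ random curve `Γ` in `D` (`IsSLECurve κ D Γ`);
* the numeric instances `exists_isSLECurve_eightThirds`, `exists_isSLECurve_three`,
  `exists_isSLECurve_sixteenThirds`, `exists_isSLECurve_six`;
* `isSLELaw_map_of_ne_eight` — hence the chordal SLE_κ law of `D` exists as a probability law on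
  curve classes: `IsSLELaw κ D (preWienerMeasure.map Γ)` for such a `Γ`.

## References

* S. Rohde, O. Schramm, *Basic properties of SLE*, Ann. of Math. 161 (2005), Thm. 5.1, Thm. 7.1.
* G. F. Lawler, O. Schramm, W. Werner, *Conformal invariance of planar loop-erased random walks
  and uniform spanning trees*, Ann. Probab. 32 (2004), Thm. 4.7 (the excluded case `κ = 8`).
-/

noncomputable section

open Filter MeasureTheory Set
open scoped NNReal

namespace Literature.Probability.RandomPlanarGeometry

variable {κ : ℝ≥0}

/-- **Chordal SLE_κ exists as a random curve in every Dobrushin domain, for every `κ > 0`,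
`κ ≠ 8`** — unconditionally: Rohde–Schramm's Thm. 5.1 (`hasSLETrace_of_ne_eight_apply`) and
Thm. 7.1 (`tendsto_norm_sleTrace_atTop_of_ne_eight`) fed into `exists_isSLECurve_at`.
[cite: RohdeSchramm2005, Thm 5.1 and Thm 7.1] -/
theorem exists_isSLECurve_of_ne_eight (hκ0 : 0 < κ) (hκ8 : κ ≠ 8) (D : DobrushinDomain) :
    ∃ Γ, IsSLECurve κ D Γ :=
  exists_isSLECurve_at (hasSLETrace_of_ne_eight_apply hκ8)
    (tendsto_norm_sleTrace_atTop_of_ne_eight hκ0 hκ8) D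

/-- Chordal SLE_{8/3} (the conjectured scaling limit of the planar self-avoiding walk,
`SAW.SAWScalingLimit`) exists as a random curve in every Dobrushin domain.
[cite: RohdeSchramm2005, Thm 5.1 and Thm 7.1] -/
theorem exists_isSLECurve_eightThirds (D : DobrushinDomain) :
    ∃ Γ, IsSLECurve ((8 : ℝ≥0) / 3) D Γ :=
  exists_isSLECurve_of_ne_eight (by positivity) (by norm_num) D

/-- Chordal SLE₃ (spin-Ising interfaces) exists as a random curve in every Dobrushin domain.
[cite: RohdeSchramm2005, Thm 5.1 and Thm 7.1] -/
theorem exists_isSLECurve_three (D : DobrushinDomain) : ∃ Γ, IsSLECurve 3 D Γ :=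
  exists_isSLECurve_of_ne_eight (by norm_num) (by norm_num) D

/-- Chordal SLE_{16/3} (FK-Ising interfaces) exists as a random curve in every Dobrushin domain.
[cite: RohdeSchramm2005, Thm 5.1 and Thm 7.1] -/
theorem exists_isSLECurve_sixteenThirds (D : DobrushinDomain) :
    ∃ Γ, IsSLECurve ((16 : ℝ≥0) / 3) D Γ :=
  exists_isSLECurve_of_ne_eight (by positivity) (by norm_num) D

/-- Chordal SLE₆ (percolation interfaces; Cardy's formula via `sle_six_measureReal_hitsBefore`)
exists as a random curve in every Dobrushin domain. [cite: RohdeSchramm2005, Thm 5.1 and Thm 7.1] -/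
theorem exists_isSLECurve_six (D : DobrushinDomain) : ∃ Γ, IsSLECurve 6 D Γ :=
  exists_isSLECurve_of_ne_eight (by norm_num) (by norm_num) D

/-- For `0 < κ ≠ 8` the chordal SLE_κ law of a Dobrushin domain exists: some probability measure on
curve classes is `IsSLELaw κ D`. [cite: RohdeSchramm2005, Thm 5.1 and Thm 7.1] -/
theorem exists_isSLELaw_of_ne_eight (hκ0 : 0 < κ) (hκ8 : κ ≠ 8) (D : DobrushinDomain) :
    ∃ μ : Measure (CurveClass ℂ), IsSLELaw κ D μ := by
  obtain ⟨Γ, hΓ⟩ := exists_isSLECurve_of_ne_eight hκ0 hκ8 D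
  exact ⟨_, Γ, hΓ, rfl⟩

end Literature.Probability.RandomPlanarGeometry

end
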